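import Summits.RiemannHypothesis.RiemannHypothesis.Theses.WeilGroundState
import Literature.NumberTheory.LFunctions.WeilWindowSuzukiProofs
import Literature.NumberTheory.LFunctions.WeilGroundStateRealZerosProofs
import Summits.RiemannHypothesis.RiemannHypothesis.Theorems.WeilGroundStateGroundStateSimpleEvenStubTransfer
import HarnessLib

/-!
# `GroundStateSimpleEven` (stmt-RiemannHypothesis-1526): negative lemmas of the standing disprover, cycle 1

Crux of route WeilGroundState, rank 2: `GroundStateSimpleEven = ∀ a > 0, WeilWindowSimpleEven a`
(`Iff.rfl`): for every window the bottom `ε(a) = weilGroundEnergy a` of `Re Q`, `Q g = W(g ⋆ g̃)`, on test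
functions supported in `[-a, a]` is simple, isolated and even, stated variationally with a witness `φ` and a
gap `δ > 0`. No refutation exists (the disprover's `Cruxes/GroundStateSimpleEven/Disproof.lean` records why:
the `∀ a` clause is RH-strength and both sector bottoms are `< 1e-12` beyond `a ≈ 0.7`); this file lands the
kernel-checked NEGATIVE knowledge around it. Every statement is inline (no new `def`), conclusions are
negations / existence of low-energy functions, never a Theses decl.

* §1 tools (odd integrals vanish: the tree's `integral_eq_zero_of_odd`): `exists_sphere_lt` (`ε(a)` is approached on the nonempty sphere), `not_gap_on_sphere`,
  `gap_on_sphere_of_sector_gaps` (sector gaps ⇒ gap on the whole sphere, via the tree's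
  `ConnesVanSuijlekom.gap_of_evenPart_orthogonal` with witness `0`).
* §2 LOAD-BEARING HYPOTHESES: the crux with the normalisation, resp. the parity/orthogonality disjunction,
  resp. the support condition deleted is FALSE (`groundStateSimpleEven_false_without_norm/_parity/_support`;
  witnesses: `g = 0` on a coercive window; the `sInf` itself; a fixed odd normalised test function against
  Bombieri coercivity `ε(a) → ∞`).
* §3 WITNESS STRUCTURE / KILL CRITERION: `bottom_attained_in_a_sector` (no window has both sectors gapped),
  `not_weilWindowSimpleEven_of_odd_le_even` (one odd normalised function below the whole even sector kills
  the window clause), `evenSector_attains` and `not_windowClause_of_odd_witness` (on `0 < a ≤ 1/100` the even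
  sector attains `ε(a)`, so no odd witness `φ`, in particular not `φ = 0`, can work).
* §4 `not_oddGroundState`: the parity-swapped crux ("simple ODD bottom") is false (window `a = 1/100`).

References: Suzuki 2026 (arXiv:2606.09096) Thm 1.4 — in the tree as
`weilGroundEnergy_add_le_of_integral_eq_zero`; Bombieri 2000 Thm 12 — `weilQuadratic_coercive`;
Connes–van Suijlekom 2025 Thm 6.1 (hypothesis) — `WeilWindowSimpleEven`.
-/

noncomputable section

open Set MeasureTheory Filter
open scoped Real Topology ComplexConjugate

namespace Summit.RiemannHypothesis.Cruxes.GroundStateSimpleEven.Negative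

open Literature.NumberTheory.LFunctions
open Literature.NumberTheory.LFunctions.ConnesVanSuijlekom (gap_of_evenPart_orthogonal)
open Summit.RiemannHypothesis.RiemannHypothesis.Theorems (integral_eq_zero_of_odd)
open Summit.RiemannHypothesis.RiemannHypothesis.Theses.WeilGroundState

/-! ## 1. Tools: the infimum is approached; sector gaps add up -/

/-- **`ε(a)` is approached on the sphere**: for `a > 0` and `δ > 0` some normalised window test
function has `Re Q(g) < ε(a) + δ` (the sphere is nonempty, `exists_isWeilTest_sphere`; no lower
bound is needed for this direction of `sInf`). [folklore] -/
theorem exists_sphere_lt {a δ : ℝ} (ha : 0 < a) (hδ : 0 < δ) :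
    ∃ g : ℝ → ℂ, IsWeilTest g ∧ tsupport g ⊆ Icc (-a) a ∧ ∫ t, ‖g t‖ ^ 2 = (1 : ℝ) ∧
      (weilQuadratic g).re < weilGroundEnergy a + δ := by
  set S : Set ℝ := {x : ℝ | ∃ g : ℝ → ℂ, IsWeilTest g ∧ tsupport g ⊆ Icc (-a) a ∧
    ∫ t : ℝ, ‖g t‖ ^ 2 = 1 ∧ x = (weilQuadratic g).re} with hS
  have hε : weilGroundEnergy a = sInf S := rfl
  have hne : S.Nonempty := by
    obtain ⟨g, hg, hsupp, hnorm⟩ := exists_isWeilTest_sphere ha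
    exact ⟨_, g, hg, hsupp, hnorm, rfl⟩
  have hlt : sInf S < weilGroundEnergy a + δ := by
    rw [← hε]
    linarith
  obtain ⟨x, ⟨g, hg, hsupp, hnorm, rfl⟩, hx⟩ := exists_lt_of_csInf_lt hne hlt
  exact ⟨g, hg, hsupp, hnorm, hx⟩

/-- **No gap on the whole sphere**: it is impossible that `(ε(a) + δ)‖k‖² ≤ Re Q(k)` for all window
test functions with `δ > 0` (apply it to a `g` of the sphere with `Re Q(g) < ε(a) + δ`). [folklore] -/
theorem not_gap_on_sphere {a δ : ℝ} (ha : 0 < a) (hδ : 0 < δ)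
    (h : ∀ k : ℝ → ℂ, IsWeilTest k → tsupport k ⊆ Icc (-a) a →
      (weilGroundEnergy a + δ) * ∫ t, ‖k t‖ ^ 2 ≤ (weilQuadratic k).re) : False := by
  obtain ⟨g, hg, hs, hn, hlt⟩ := exists_sphere_lt ha hδ
  have := h g hg hs
  rw [hn, mul_one] at this
  linarith

/-- **Sector gaps add up to a gap on the whole sphere** (parity splitting of `Re Q` and of `‖·‖²`,
packaged in the tree as `gap_of_evenPart_orthogonal` with the witness `φ = 0`): if odd AND even
normalised window test functions both lie `≥ ε(a) + δ`, then `(ε(a) + δ)‖k‖² ≤ Re Q(k)` for every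
window test function `k`. [folklore] -/
theorem gap_on_sphere_of_sector_gaps {a δ : ℝ}
    (hodd : ∀ g : ℝ → ℂ, IsWeilTest g → tsupport g ⊆ Icc (-a) a → ∫ t, ‖g t‖ ^ 2 = (1 : ℝ) →
      (∀ t, g (-t) = -g t) → weilGroundEnergy a + δ ≤ (weilQuadratic g).re)
    (heven : ∀ g : ℝ → ℂ, IsWeilTest g → tsupport g ⊆ Icc (-a) a → ∫ t, ‖g t‖ ^ 2 = (1 : ℝ) →
      (∀ t, g (-t) = g t) → weilGroundEnergy a + δ ≤ (weilQuadratic g).re) :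
    ∀ k : ℝ → ℂ, IsWeilTest k → tsupport k ⊆ Icc (-a) a →
      (weilGroundEnergy a + δ) * ∫ t, ‖k t‖ ^ 2 ≤ (weilQuadratic k).re := by
  intro k hk hks
  have hH : ∀ g : ℝ → ℂ, IsWeilTest g → tsupport g ⊆ Icc (-a) a → ∫ t, ‖g t‖ ^ 2 = (1 : ℝ) →
      ((∀ t, g (-t) = -g t) ∨ ((∀ t, g (-t) = g t) ∧ ∫ t, conj ((0 : ℝ → ℂ) t) * g t = 0)) →
        weilGroundEnergy a + δ ≤ (weilQuadratic g).re := fun g hg hs hn hpar ↦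
    hpar.elim (hodd g hg hs hn) (fun h ↦ heven g hg hs hn h.1)
  exact gap_of_evenPart_orthogonal hH hk hks (by simp)

/-! ## 2. Load-bearing hypotheses: the crux with one hypothesis deleted is FALSE (statements inline) -/

/-- **Any proof must use the normalisation**: without it `g = 0` (odd, `Q(0) = 0`) is admissible, but
`ε(a) > 0` on small windows (`exists_weilGroundEnergy_pos`, Bombieri/Yoshida coercivity in the tree).
[folklore] -/
theorem groundStateSimpleEven_false_without_norm :
    ¬ ∀ a : ℝ, 0 < a → ∃ φ : ℝ → ℂ, ∃ δ : ℝ, 0 < δ ∧ ∀ g : ℝ → ℂ, IsWeilTest g →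
        tsupport g ⊆ Icc (-a) a →
          ((∀ t, g (-t) = -g t) ∨ ((∀ t, g (-t) = g t) ∧ ∫ t, starRingEnd ℂ (φ t) * g t = 0)) →
            weilGroundEnergy a + δ ≤ (weilQuadratic g).re := by
  intro h
  obtain ⟨a₁, ha₁, hpos⟩ := exists_weilGroundEnergy_pos
  obtain ⟨φ, δ, hδ, hcl⟩ := h a₁ ha₁
  have ht : IsWeilTest (0 : ℝ → ℂ) := ⟨contDiff_const, HasCompactSupport.zero⟩
  have hs : tsupport (0 : ℝ → ℂ) ⊆ Icc (-a₁) a₁ := by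
    rw [tsupport_eq_empty_iff.2 rfl]
    exact empty_subset _
  have h0 := hcl 0 ht hs (Or.inl fun t ↦ by simp)
  rw [weilQuadratic_zero, Complex.zero_re] at h0
  linarith [hpos a₁ ha₁ le_rfl]

/-- **Any proof must use the parity/orthogonality hypothesis**: without it the clause says the whole
sphere lies `≥ ε(a) + δ`, contradicting the definition of `ε(a)` as an infimum over a nonempty set
(witness window `a = 1`). [folklore] -/
theorem groundStateSimpleEven_false_without_parity :
    ¬ ∀ a : ℝ, 0 < a → ∃ _φ : ℝ → ℂ, ∃ δ : ℝ, 0 < δ ∧ ∀ g : ℝ → ℂ, IsWeilTest g →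
        tsupport g ⊆ Icc (-a) a → ∫ t, ‖g t‖ ^ 2 = (1 : ℝ) →
          weilGroundEnergy a + δ ≤ (weilQuadratic g).re := by
  intro h
  obtain ⟨-, δ, hδ, hcl⟩ := h 1 one_pos
  obtain ⟨g, hg, hsupp, hnorm, hlt⟩ := exists_sphere_lt one_pos hδ
  linarith [hcl g hg hsupp hnorm]

/-- **An odd normalised test function exists** (two far-apart translates `g(t - 3) - g(-t - 3)` of an
element of the unit sphere of the window `[-1, 1]`, rescaled by `1/√2`; the translates have disjoint
supports, so the norms add). [folklore] -/
theorem exists_odd_sphere :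
    ∃ o : ℝ → ℂ, IsWeilTest o ∧ (∀ t, o (-t) = -o t) ∧ ∫ t, ‖o t‖ ^ 2 = (1 : ℝ) := by
  obtain ⟨g, hg, hsupp, hnorm⟩ := exists_isWeilTest_sphere one_pos
  set g₁ : ℝ → ℂ := fun t ↦ g (t + (-3)) with hg₁
  set g₂ : ℝ → ℂ := fun t ↦ g₁ (-t) with hg₂
  have hg₁t : IsWeilTest g₁ := isWeilTest_translate hg (-3)
  have hg₂t : IsWeilTest g₂ := hg₁t.comp_neg
  set c : ℝ := (Real.sqrt 2)⁻¹ with hc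
  have hcpos : 0 < c := inv_pos.2 (Real.sqrt_pos.2 two_pos)
  have hcsq : c ^ 2 = 1 / 2 := by
    rw [hc, inv_pow, Real.sq_sqrt (by norm_num : (0 : ℝ) ≤ 2), one_div]
  set o : ℝ → ℂ := fun t ↦ (c : ℂ) * ((g₁ + fun t ↦ (-1 : ℂ) * g₂ t) t) with ho
  have hot : IsWeilTest o := (hg₁t.add (hg₂t.const_mul (-1))).const_mul c
  -- the two translates never overlap
  have hzero : ∀ t : ℝ, g₁ t = 0 ∨ g₂ t = 0 := by
    intro t
    by_cases ht : t ≤ 0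
    · left
      show g (t + (-3)) = 0
      refine image_eq_zero_of_notMem_tsupport fun hmem ↦ ?_
      have := hsupp hmem
      simp only [mem_Icc] at this
      linarith [this.1]
    · right
      show g (-t + (-3)) = 0
      refine image_eq_zero_of_notMem_tsupport fun hmem ↦ ?_
      have := hsupp hmem
      simp only [mem_Icc] at this
      linarith [this.1]
  have hpt : ∀ t : ℝ, ‖o t‖ ^ 2 = (1 / 2 : ℝ) * (‖g₁ t‖ ^ 2 + ‖g₂ t‖ ^ 2) := by
    intro t
    have e1 : o t = (c : ℂ) * (g₁ t - g₂ t) := by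
      simp only [ho, Pi.add_apply]
      ring
    rw [e1, norm_mul, mul_pow, Complex.norm_real, Real.norm_of_nonneg hcpos.le, hcsq]
    rcases hzero t with h0 | h0 <;> simp [h0]
  refine ⟨o, hot, fun t ↦ ?_, ?_⟩
  · simp only [ho, Pi.add_apply, hg₂, neg_neg]
    ring
  · simp_rw [hpt]
    rw [integral_const_mul, integral_add hg₁t.integrable_norm_sq hg₂t.integrable_norm_sq]
    have h1 : ∫ t, ‖g₁ t‖ ^ 2 = 1 := by rw [hg₁, integral_norm_sq_translate, hnorm]
    have h2 : ∫ t, ‖g₂ t‖ ^ 2 = 1 := by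
      rw [← h1]
      exact integral_neg_eq_self (fun t ↦ ‖g₁ t‖ ^ 2) volume
    rw [h1, h2]
    norm_num

/-- **Any proof must use the support condition**: a FIXED odd normalised test function `o` (any
support) has a fixed energy `q = Re Q(o)`, while `ε(a) → +∞` as `a → 0⁺` (Bombieri's coercivity
`weilQuadratic_coercive` in the tree): at a window `a₀` with `ε(a₀) ≥ q + 1` the support-free clause
fails for `o`. [folklore] -/
theorem groundStateSimpleEven_false_without_support :
    ¬ ∀ a : ℝ, 0 < a → ∃ φ : ℝ → ℂ, ∃ δ : ℝ, 0 < δ ∧ ∀ g : ℝ → ℂ, IsWeilTest g →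
        ∫ t, ‖g t‖ ^ 2 = (1 : ℝ) →
          ((∀ t, g (-t) = -g t) ∨ ((∀ t, g (-t) = g t) ∧ ∫ t, starRingEnd ℂ (φ t) * g t = 0)) →
            weilGroundEnergy a + δ ≤ (weilQuadratic g).re := by
  intro h
  obtain ⟨o, hot, hodd, hon⟩ := exists_odd_sphere
  set q : ℝ := (weilQuadratic o).re with hq
  obtain ⟨a₀, ha₀, hco⟩ := weilQuadratic_coercive (q + 1)
  have hne : {x : ℝ | ∃ g : ℝ → ℂ, IsWeilTest g ∧ tsupport g ⊆ Icc (-a₀) a₀ ∧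
      ∫ t : ℝ, ‖g t‖ ^ 2 = 1 ∧ x = (weilQuadratic g).re}.Nonempty := by
    obtain ⟨g, hg, hsupp, hnorm⟩ := exists_isWeilTest_sphere ha₀
    exact ⟨_, g, hg, hsupp, hnorm, rfl⟩
  have hε : q + 1 ≤ weilGroundEnergy a₀ := by
    refine le_csInf hne ?_
    rintro x ⟨g, hg, hs, hn, rfl⟩
    have := hco a₀ ha₀ le_rfl g hg hs
    rwa [hn, mul_one] at this
  obtain ⟨φ, δ, hδ, hcl⟩ := h a₀ ha₀
  have := hcl o hot hon (Or.inl hodd)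
  linarith

/-! ## 3. Structure of the witness; the kill criterion -/

/-- **At every window at least one parity sector attains `ε(a)`**: there is no `δ > 0` with both the
odd and the even normalised window test functions `≥ ε(a) + δ` (so the strengthening of the crux with
the witness-free even branch — "both sectors gapped" — is false at EVERY window). [folklore] -/
theorem bottom_attained_in_a_sector {a δ : ℝ} (ha : 0 < a) (hδ : 0 < δ)
    (hodd : ∀ g : ℝ → ℂ, IsWeilTest g → tsupport g ⊆ Icc (-a) a → ∫ t, ‖g t‖ ^ 2 = (1 : ℝ) →
      (∀ t, g (-t) = -g t) → weilGroundEnergy a + δ ≤ (weilQuadratic g).re)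
    (heven : ∀ g : ℝ → ℂ, IsWeilTest g → tsupport g ⊆ Icc (-a) a → ∫ t, ‖g t‖ ^ 2 = (1 : ℝ) →
      (∀ t, g (-t) = g t) → weilGroundEnergy a + δ ≤ (weilQuadratic g).re) : False :=
  not_gap_on_sphere ha hδ (gap_on_sphere_of_sector_gaps hodd heven)

/-- **KILL CRITERION.** The window clause at `a > 0` is refuted by ONE odd normalised window test
function `o` whose energy is `≤` that of every even normalised window test function: then the odd
branch of the clause puts `o` at `≥ ε(a) + δ`, the even sector follows, and both sectors would be
gapped. (What a certified refutation must produce: an upper bound for one odd Rayleigh quotient below a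
LOWER bound for the whole even sector.) [folklore] -/
theorem not_weilWindowSimpleEven_of_odd_le_even {a : ℝ} (ha : 0 < a) {o : ℝ → ℂ}
    (ho : IsWeilTest o) (hos : tsupport o ⊆ Icc (-a) a) (hon : ∫ t, ‖o t‖ ^ 2 = (1 : ℝ))
    (hodd : ∀ t, o (-t) = -o t)
    (hle : ∀ e : ℝ → ℂ, IsWeilTest e → tsupport e ⊆ Icc (-a) a → ∫ t, ‖e t‖ ^ 2 = (1 : ℝ) →
      (∀ t, e (-t) = e t) → (weilQuadratic o).re ≤ (weilQuadratic e).re) :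
    ¬ WeilWindowSimpleEven a := by
  rintro ⟨φ, δ, hδ, hH⟩
  have hoδ : weilGroundEnergy a + δ ≤ (weilQuadratic o).re := hH o ho hos hon (Or.inl hodd)
  refine bottom_attained_in_a_sector ha hδ (fun g hg hs hn hg' ↦ hH g hg hs hn (Or.inl hg'))
    fun e he hes hen hev ↦ hoδ.trans (hle e he hes hen hev)

/-- **The even sector attains `ε(a)` on Suzuki's windows** `0 < a ≤ 1/100`: for every `δ > 0` some
EVEN normalised window test function has `Re Q < ε(a) + δ` (the tree's mean-zero gap
`weilGroundEnergy_add_le_of_integral_eq_zero` puts the odd sector `≥ ε(a) + 1/10`, and both sectors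
cannot be gapped). [cite: Suzuki2026, Thm. 1.4] -/
theorem evenSector_attains {a δ : ℝ} (ha : 0 < a) (ha' : a ≤ 1 / 100) (hδ : 0 < δ) :
    ∃ e : ℝ → ℂ, IsWeilTest e ∧ tsupport e ⊆ Icc (-a) a ∧ ∫ t, ‖e t‖ ^ 2 = (1 : ℝ) ∧
      (∀ t, e (-t) = e t) ∧ (weilQuadratic e).re < weilGroundEnergy a + δ := by
  by_contra hne
  have hne' : ∀ e : ℝ → ℂ, IsWeilTest e → tsupport e ⊆ Icc (-a) a → ∫ t, ‖e t‖ ^ 2 = (1 : ℝ) →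
      (∀ t, e (-t) = e t) → weilGroundEnergy a + δ ≤ (weilQuadratic e).re :=
    fun e he hes hen hev ↦ not_lt.1 fun hlt ↦ hne ⟨e, he, hes, hen, hev, hlt⟩
  have hδ' : 0 < min δ (1 / 10) := lt_min hδ (by norm_num)
  refine bottom_attained_in_a_sector ha hδ' (fun g hg hs hn hodd ↦ ?_) fun g hg hs hn hev ↦ ?_
  · have hmean : ∫ x : ℝ, g x = 0 := integral_eq_zero_of_odd hodd
    have := weilGroundEnergy_add_le_of_integral_eq_zero hg ha ha' hs hn hmean
    linarith [min_le_right δ (1 / 10)]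
  · linarith [hne' g hg hs hn hev, min_le_left δ (1 / 10)]

/-- **The witness must see the even sector**: on `0 < a ≤ 1/100` NO odd `φ` (in particular not
`φ = 0`) can serve as the witness of the window clause, whatever `δ > 0`: every even `g` is then
automatically "orthogonal" to `φ` (odd integrand), and the even sector attains `ε(a)`. Provers: the
`∃ φ` is load-bearing through its even part's pairing with the ground state (the line's `φ = 1` is fine
numerically: `⟨u,1⟩ ∈ [0.3, 0.85]` on the whole scanned grid). [folklore] -/
theorem not_windowClause_of_odd_witness {a δ : ℝ} (ha : 0 < a) (ha' : a ≤ 1 / 100) (hδ : 0 < δ)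
    {φ : ℝ → ℂ} (hφ : ∀ t, φ (-t) = -φ t) :
    ¬ ∀ g : ℝ → ℂ, IsWeilTest g → tsupport g ⊆ Icc (-a) a → ∫ t, ‖g t‖ ^ 2 = (1 : ℝ) →
        ((∀ t, g (-t) = -g t) ∨ ((∀ t, g (-t) = g t) ∧ ∫ t, starRingEnd ℂ (φ t) * g t = 0)) →
          weilGroundEnergy a + δ ≤ (weilQuadratic g).re := by
  intro hH
  obtain ⟨e, he, hes, hen, hev, hlt⟩ := evenSector_attains ha ha' hδ
  have horth : ∫ t, starRingEnd ℂ (φ t) * e t = 0 :=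
    integral_eq_zero_of_odd fun t ↦ by rw [hφ, hev, map_neg, neg_mul]
  linarith [hH e he hes hen (Or.inr ⟨hev, horth⟩)]

/-! ## 4. The parity-swapped crux ("simple ODD bottom") is false -/

/-- **The parity-swapped crux is false** (witness window `a = 1/100`, where the even sector attains
`ε(a)`): parity is not a symmetric bookkeeping choice in this problem — the even sector wins on small
windows (Suzuki), and numerically on every probed window up to `a = 1.2`. [cite: Suzuki2026, Thm. 1.4] -/
theorem not_oddGroundState :
    ¬ ∀ a : ℝ, 0 < a → ∃ φ : ℝ → ℂ, ∃ δ : ℝ, 0 < δ ∧ ∀ g : ℝ → ℂ, IsWeilTest g →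
        tsupport g ⊆ Icc (-a) a → ∫ t, ‖g t‖ ^ 2 = (1 : ℝ) →
          ((∀ t, g (-t) = g t) ∨ ((∀ t, g (-t) = -g t) ∧ ∫ t, starRingEnd ℂ (φ t) * g t = 0)) →
            weilGroundEnergy a + δ ≤ (weilQuadratic g).re := by
  intro h
  obtain ⟨φ, δ, hδ, hcl⟩ := h (1 / 100) (by norm_num)
  obtain ⟨e, he, hes, hen, hev, hlt⟩ := evenSector_attains (a := 1 / 100) (by norm_num) le_rfl hδ
  linarith [hcl e he hes hen (Or.inl hev)]


end Summit.RiemannHypothesis.Cruxes.GroundStateSimpleEven.Negative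

end
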